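import Summits.MatrixMultiplication.OmegaCensus.SmallFormats.MatMul22nRankGF7Slack6SearchSound
import Summits.MatrixMultiplication.OmegaCensus.SmallFormats.MatMul22nRankGF7Slack6SearchFacts2
import Summits.MatrixMultiplication.OmegaCensus.SmallFormats.MatMul22nRankGF7Slack6SearchFacts3
import Summits.MatrixMultiplication.OmegaCensus.SmallFormats.MatMul22nRankGF7Slack6SearchFacts4
import Summits.MatrixMultiplication.OmegaCensus.SmallFormats.MatMul22nRankGF7Slack6KeyFacts1
import Summits.MatrixMultiplication.OmegaCensus.SmallFormats.MatMul22nRankGF7Slack6KeyFacts2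
import Summits.MatrixMultiplication.OmegaCensus.SmallFormats.MatMul22nRankGF7Slack6KeyFacts3
import Summits.MatrixMultiplication.OmegaCensus.SmallFormats.MatMul22nRankGF7Slack6KeyFacts4
import Summits.MatrixMultiplication.OmegaCensus.SmallFormats.MatMul22nRankGF7Slack6KeyFacts5
import Summits.MatrixMultiplication.OmegaCensus.SmallFormats.MatMul22nRankGF7Slack6KeyFacts6
import Summits.MatrixMultiplication.OmegaCensus.SmallFormats.MatMul22nRankGF7Slack6KeyFacts7
import Summits.MatrixMultiplication.OmegaCensus.SmallFormats.MatMul22nRankGF7Slack6KeyFacts8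
import HarnessLib

/-!
# ω-census family (a): soundness of the slack-6 search checker K6 — instantiating the table facts; level 1; `search6_sound`

Cell `pub-omega` (unit `pub-omega-tensor-g17` / `pub-omega-tensor-g18`), topic `Summits/MatrixMultiplication/OmegaCensus` (sub-folder `SmallFormats`).
Framing (verbatim): lottery ticket; floor = certified bounds/negative ranges. HONEST FRAMING: kernel infrastructure — the last part of the
soundness proof of `MatMul22nRankGF7Slack6Search` (`pub-omega-tensor-g17/KERNEL-S6-DESIGN.md` §2, `pub-omega-tensor-g18/KERNEL-S6-SPLIT.md`):
`search6_sound` — if every lane of the total plane of every element passes (`LanesOK6 h 0 3692`, the piecewise form of `mainOK6 h`) and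
`SearchT6 c` holds (the piecewise form of `searchT6 c`), no LP-tight point of the slack-6 `𝔽₇` X-cap system has torus-0 column `repVal6 c`;
`noTightPoint7_6_312_of_replay` reduces `NoTightPoint7 6 312` to the two replayed facts. The replays (`MatMul22nRankGF7Slack6RunT*/RunM*`) and
the assembly are sibling files. Written by tensor g17, interfaces and level-1 argument reworked by tensor g18. Nothing here is progress on `ω`.
-/

namespace Summit.MatrixMultiplication.OmegaCensus.SmallFormats

open Finset

set_option exponentiation.threshold 100000

/-! ## Level case analyses (by `decide` over `Fin 21`) -/

/-- The bucket levels. -/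
theorem k6IsBkt_cases {L : ℕ} (hL : L < 21) (hB : k6IsBkt L = true) : L = 1 ∨ L = 2 ∨ L = 3 ∨ L = 4 ∨ L = 5 ∨ L = 7 ∨ L = 13 := by
  have h : ∀ M : Fin 21, k6IsBkt M.val = true →
      M.val = 1 ∨ M.val = 2 ∨ M.val = 3 ∨ M.val = 4 ∨ M.val = 5 ∨ M.val = 7 ∨ M.val = 13 := by decide
  exact h ⟨L, hL⟩ hB

/-- The determined levels. -/
theorem k6NFree_zero_cases {L : ℕ} (hL : L < 21) (hL1 : 1 ≤ L) (hD : k6NFree L = 0) :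
    L = 6 ∨ L = 8 ∨ L = 9 ∨ L = 10 ∨ L = 11 ∨ L = 12 ∨ L = 14 ∨ L = 15 ∨ L = 16 ∨ L = 17 ∨ L = 18 ∨ L = 19 ∨ L = 20 := by
  have h : ∀ M : Fin 21, 1 ≤ M.val → k6NFree M.val = 0 → M.val = 6 ∨ M.val = 8 ∨ M.val = 9 ∨ M.val = 10 ∨ M.val = 11 ∨ M.val = 12 ∨
      M.val = 14 ∨ M.val = 15 ∨ M.val = 16 ∨ M.val = 17 ∨ M.val = 18 ∨ M.val = 19 ∨ M.val = 20 := by decide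
  exact h ⟨L, hL⟩ hL1 hD

/-- The levels with cross relations are the bucket levels. -/
theorem k6Ncr_cases {L : ℕ} (hL : L < 21) : k6Ncr L = 0 ∨ L = 1 ∨ L = 2 ∨ L = 3 ∨ L = 4 ∨ L = 5 ∨ L = 7 ∨ L = 13 := by
  have h : ∀ M : Fin 21, k6Ncr M.val = 0 ∨ M.val = 1 ∨ M.val = 2 ∨ M.val = 3 ∨ M.val = 4 ∨ M.val = 5 ∨ M.val = 7 ∨ M.val = 13 := by
    decide
  exact h ⟨L, hL⟩

/-- A bucket level is below 21 (the dispatcher `k6IsBkt` is a finite disjunction). -/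
theorem lt_of_k6IsBkt {L : ℕ} (hB : k6IsBkt L = true) : L < 21 := by
  unfold k6IsBkt at hB
  simp only [Bool.or_eq_true, beq_iff_eq] at hB
  omega

/-! ## The table facts, per level -/

/-- The `ag6` shape/bound facts for every bucket level (vacuous elsewhere). -/
theorem ag6_facts : ∀ L < 21, ∀ j < k6Ncr L, ag6 L j = packW 14 (fun k => acoef6 L j (41 - k)) 42 ∧ ∀ z < 42, acoef6 L j z ≤ 6 := by
  intro L hL j hj
  have hncr := k6Ncr_cases hL
  rcases hncr with h0 | rfl | rfl | rfl | rfl | rfl | rfl | rfl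
  · omega
  · exact ⟨(shapeFacts6_1).2.2 ⟨j, hj⟩, fun z hz => (crossFacts6_1 ⟨j, hj⟩).2.2.2.2.1 ⟨z, hz⟩⟩
  · exact ⟨(shapeFacts6_2).2.2 ⟨j, hj⟩, fun z hz => (crossFacts6_2 ⟨j, hj⟩).2.2.2.2.1 ⟨z, hz⟩⟩
  · exact ⟨(shapeFacts6_3).2.2 ⟨j, hj⟩, fun z hz => (crossFacts6_3 ⟨j, hj⟩).2.2.2.2.1 ⟨z, hz⟩⟩
  · exact ⟨(shapeFacts6_4).2.2 ⟨j, hj⟩, fun z hz => (crossFacts6_4 ⟨j, hj⟩).2.2.2.2.1 ⟨z, hz⟩⟩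
  · exact ⟨(shapeFacts6_5).2.2 ⟨j, hj⟩, fun z hz => (crossFacts6_5 ⟨j, hj⟩).2.2.2.2.1 ⟨z, hz⟩⟩
  · exact ⟨(shapeFacts6_7).2.2 ⟨j, hj⟩, fun z hz => (crossFacts6_7 ⟨j, hj⟩).2.2.2.2.1 ⟨z, hz⟩⟩
  · exact ⟨(shapeFacts6_13).2.2 ⟨j, hj⟩, fun z hz => (crossFacts6_13 ⟨j, hj⟩).2.2.2.2.1 ⟨z, hz⟩⟩

/-- `needKey6_eq` with the facts of a given bucket level supplied in `Fin` form. -/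
theorem needKey6_eq_of {L : ℕ} (hL : L < 21) (hB : k6IsBkt L = true) (x : ℕ → ℕ) (hx : ∀ j < 21, ∀ z < 42, colN7 x j z ≤ 6)
    (hT : ∀ t < 384, xrs7 x t = 6) (hR : ∀ k < 8, xrs7 x (1266 + k) = 2 * (6 : ℤ))
    (hcf : ∀ j : Fin (k6Ncr L), levStart6 L ≤ crossRel6 L j.val ∧ crossRel6 L j.val < levStart6 (L + 1) ∧
      (∀ u : Fin 882, fld 3 (relA6 (crossRel6 L j.val)) u.val = coefCross6 L j.val u.val) ∧ ccoef6 L j.val = relC6 (crossRel6 L j.val) ∧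
      (∀ z : Fin 42, acoef6 L j.val z.val ≤ 6) ∧ (∀ i : Fin (k6Base L), ecoef6 L j.val i.val ≤ 6))
    (hshape : relE6 L = packW 1752 (fun j => packW 12 (fun k => ecoef6 L j (k6Base L - 1 - k)) (k6Base L)) (k6Ncr L) ∧
      relCL6 L = packW 1752 (ccoef6 L) (k6Ncr L) ∧ (∀ j : Fin (k6Ncr L), ag6 L j.val = packW 14 (fun k => acoef6 L j.val (41 - k)) 42))
    (hls : levStart6 (L + 1) ≤ 785) :
    needKey6 L (stateW6 x L) = colKey6 L (colN7 x (torOf6 L)) :=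
  needKey6_eq hL hB x hx hT hR (fun j hj => by
    obtain ⟨a, b, c, d, e, f⟩ := hcf ⟨j, hj⟩
    exact ⟨a, b, c, d, fun z hz => e ⟨z, hz⟩, fun i hi => f ⟨i, hi⟩⟩) ⟨hshape.1, hshape.2.1⟩ hls

/-- `detRes6_eq` with the facts of a given determined level supplied in `Fin` form. -/
theorem detRes6_eq_of {L : ℕ} (hL : L < 21) (hL1 : 1 ≤ L) (x : ℕ → ℕ) (hx : ∀ j < 21, ∀ z < 42, colN7 x j z ≤ 6)
    (hT : ∀ t < 384, xrs7 x t = 6) (hR : ∀ k < 8, xrs7 x (1266 + k) = 2 * (6 : ℤ))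
    (hdf : ∀ z : Fin 42, (∀ u : Fin 882, fld 3 (relA6 (levStart6 L + z.val)) u.val = coefDet6 L z.val u.val) ∧
      dccoef6 L z.val = relC6 (levStart6 L + z.val) ∧ (∀ i : Fin (k6Base L), dcoef6 L z.val i.val ≤ 6))
    (hshape : relD6 L = packW 1752 (fun z => packW 12 (fun k => dcoef6 L z (k6Base L - 1 - k)) (k6Base L)) 42 ∧
      relCD6 L = packW 1752 (dccoef6 L) 42) (hls : levStart6 L + 41 < 785) :
    detRes6 L (stateW6 x L) = packW 1752 (colN7 x (torOf6 L)) 42 :=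
  detRes6_eq hL hL1 x hx hT hR (fun z hz => by
    obtain ⟨a, b, c⟩ := hdf ⟨z, hz⟩
    exact ⟨a, b, fun i hi => c ⟨i, hi⟩⟩) hshape hls

/-- **All level facts at an LP-tight point of slack 6 with slack-6 pattern columns.** -/
theorem levFacts6 (x : ℕ → ℕ) (hx : ∀ j < 21, ∀ z < 42, colN7 x j z ≤ 6) (hT : ∀ t < 384, xrs7 x t = 6)
    (hR : ∀ k < 8, xrs7 x (1266 + k) = 2 * (6 : ℤ)) : LevFacts6 x := by
  refine ⟨fun L hL hB => ?_, fun L hL hL1 hD => ?_⟩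
  · have hcases := k6IsBkt_cases hL hB
    rcases hcases with rfl | rfl | rfl | rfl | rfl | rfl | rfl
    · exact needKey6_eq_of hL hB x hx hT hR crossFacts6_1 shapeFacts6_1 (by decide)
    · exact needKey6_eq_of hL hB x hx hT hR crossFacts6_2 shapeFacts6_2 (by decide)
    · exact needKey6_eq_of hL hB x hx hT hR crossFacts6_3 shapeFacts6_3 (by decide)
    · exact needKey6_eq_of hL hB x hx hT hR crossFacts6_4 shapeFacts6_4 (by decide)
    · exact needKey6_eq_of hL hB x hx hT hR crossFacts6_5 shapeFacts6_5 (by decide)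
    · exact needKey6_eq_of hL hB x hx hT hR crossFacts6_7 shapeFacts6_7 (by decide)
    · exact needKey6_eq_of hL hB x hx hT hR crossFacts6_13 shapeFacts6_13 (by decide)
  · have hcases := k6NFree_zero_cases hL hL1 hD
    rcases hcases with rfl | rfl | rfl | rfl | rfl | rfl | rfl | rfl | rfl | rfl | rfl | rfl | rfl
    · exact detRes6_eq_of hL hL1 x hx hT hR detFacts6_6 dshapeFacts6_6 (by decide)
    · exact detRes6_eq_of hL hL1 x hx hT hR detFacts6_8 dshapeFacts6_8 (by decide)
    · exact detRes6_eq_of hL hL1 x hx hT hR detFacts6_9 dshapeFacts6_9 (by decide)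
    · exact detRes6_eq_of hL hL1 x hx hT hR detFacts6_10 dshapeFacts6_10 (by decide)
    · exact detRes6_eq_of hL hL1 x hx hT hR detFacts6_11 dshapeFacts6_11 (by decide)
    · exact detRes6_eq_of hL hL1 x hx hT hR detFacts6_12 dshapeFacts6_12 (by decide)
    · exact detRes6_eq_of hL hL1 x hx hT hR detFacts6_14 dshapeFacts6_14 (by decide)
    · exact detRes6_eq_of hL hL1 x hx hT hR detFacts6_15 dshapeFacts6_15 (by decide)
    · exact detRes6_eq_of hL hL1 x hx hT hR detFacts6_16 dshapeFacts6_16 (by decide)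
    · exact detRes6_eq_of hL hL1 x hx hT hR detFacts6_17 dshapeFacts6_17 (by decide)
    · exact detRes6_eq_of hL hL1 x hx hT hR detFacts6_18 dshapeFacts6_18 (by decide)
    · exact detRes6_eq_of hL hL1 x hx hT hR detFacts6_19 dshapeFacts6_19 (by decide)
    · exact detRes6_eq_of hL hL1 x hx hT hR detFacts6_20 dshapeFacts6_20 (by decide)

/-! ## Table keys are flagged by the bitmaps -/

/-- Keys are below `7^ncr`. -/
theorem colKey6_lt7 (L : ℕ) (Q : ℕ → ℕ) : colKey6 L Q < 7 ^ k6Ncr L := by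
  unfold colKey6
  calc ∑ j ∈ range (k6Ncr L), (∑ z ∈ range 42, acoef6 L j z * Q z) % 7 * 7 ^ j ≤ ∑ j ∈ range (k6Ncr L), 6 * 7 ^ j :=
        sum_le_sum fun j _ => Nat.mul_le_mul_right _ (by have := Nat.mod_lt (∑ z ∈ range 42, acoef6 L j z * Q z) (by norm_num : 0 < 7); omega)
    _ < 7 ^ k6Ncr L := sum_six_pow_lt _

/-- `gfind6` stays at or above its lower bound. -/
theorem gfind6_ge (L lo : ℕ) : ∀ fuel a b, a ≤ gfind6 L lo fuel a b := by
  intro fuel; induction fuel with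
  | zero => intro a b; simp [gfind6]
  | succ fuel ih =>
    intro a b; unfold gfind6
    split_ifs
    · exact le_rfl
    · exact le_trans (by omega) (ih _ _)
    · exact ih _ _

/-- If `lookup6` finds a key, the key is the `j`-th table key of its group `g = K / k6LoMod L`. -/
theorem lookup6_key {L K s e : ℕ} (hl : lookup6 L K = some (s, e)) :
    ∃ j, goff6 L (K / k6LoMod L) ≤ j ∧ j < goff6 L (K / k6LoMod L + 1) ∧ K = K / k6LoMod L * k6LoMod L + low6 L j := by
  by_cases hc : gfind6 L (K % k6LoMod L) 6 (goff6 L (K / k6LoMod L)) (goff6 L (K / k6LoMod L + 1)) < goff6 L (K / k6LoMod L + 1) ∧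
      low6 L (gfind6 L (K % k6LoMod L) 6 (goff6 L (K / k6LoMod L)) (goff6 L (K / k6LoMod L + 1))) = K % k6LoMod L
  · exact ⟨_, gfind6_ge _ _ _ _ _, hc.1, by rw [hc.2]; exact (Nat.div_add_mod' K (k6LoMod L)).symm⟩
  · unfold lookup6 at hl
    simp [hc] at hl

/-! ### Level bitmaps: the per-part `decide`s of `MatMul22nRankGF7Slack6KeyFacts1…8` glued per level (tensor g19: the glue moved here so that all eight fact files are independent of one another; the facts are decided on the flat accessors, `allUpTo` of `MatMul22nRankGF7Slack6FlatMain`) -/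

/-- **Level 2: every table key is flagged by the level's bitmap** (keys enumerated by group and position). -/
theorem bmKeys6_2 : ∀ g < 16807, ∀ t < goff6 2 (g + 1) - goff6 2 g, bm6 2 ((g * k6LoMod 2 + low6 2 (goff6 2 g + t)) % 2 ^ bmb6 2) = 1 := by
  intro g hg t ht
  by_cases h1 : g < 5603
  · exact (beq_iff_eq).1 (allUpTo_sound (allUpTo_sound bmKeysB6_2a g h1) t ht)
  by_cases h2 : g < 11206
  · have h := allUpTo_sound bmKeysB6_2b (g - 5603) (by omega)
    rw [show 5603 + (g - 5603) = g by omega] at h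
    exact (beq_iff_eq).1 (allUpTo_sound h t ht)
  · have h := allUpTo_sound bmKeysB6_2c (g - 11206) (by omega)
    rw [show 11206 + (g - 11206) = g by omega] at h
    exact (beq_iff_eq).1 (allUpTo_sound h t ht)

/-- **Level 3: every table key is flagged by the level's bitmap** (keys enumerated by group and position). -/
theorem bmKeys6_3 : ∀ g < 16807, ∀ t < goff6 3 (g + 1) - goff6 3 g, bm6 3 ((g * k6LoMod 3 + low6 3 (goff6 3 g + t)) % 2 ^ bmb6 3) = 1 := by
  intro g hg t ht
  by_cases hlt : g < 8404
  · exact (beq_iff_eq).1 (allUpTo_sound (allUpTo_sound bmKeysB6_3a g hlt) t ht)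
  · have h := allUpTo_sound bmKeysB6_3b (g - 8404) (by omega)
    rw [show 8404 + (g - 8404) = g by omega] at h
    exact (beq_iff_eq).1 (allUpTo_sound h t ht)

/-- **Level 4: every table key is flagged by the level's bitmap** (keys enumerated by group and position). -/
theorem bmKeys6_4 : ∀ g < 16807, ∀ t < goff6 4 (g + 1) - goff6 4 g, bm6 4 ((g * k6LoMod 4 + low6 4 (goff6 4 g + t)) % 2 ^ bmb6 4) = 1 := by
  intro g hg t ht
  by_cases hlt : g < 8404
  · exact (beq_iff_eq).1 (allUpTo_sound (allUpTo_sound bmKeysB6_4a g hlt) t ht)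
  · have h := allUpTo_sound bmKeysB6_4b (g - 8404) (by omega)
    rw [show 8404 + (g - 8404) = g by omega] at h
    exact (beq_iff_eq).1 (allUpTo_sound h t ht)

/-- **Every table key is flagged by its level's bitmap** (keys `< 7^ncr`). -/
theorem bm6_of_table {L K s e : ℕ} (hB : k6IsBkt L = true) (hK : K < 7 ^ k6Ncr L) (hl : lookup6 L K = some (s, e)) :
    bm6 L (K % 2 ^ bmb6 L) = 1 := by
  obtain ⟨j, hge, hlt, hKeq⟩ := lookup6_key hl
  have hcases := k6IsBkt_cases (lt_of_k6IsBkt hB) hB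
  -- group index below the number of groups
  have hM : 0 < k6LoMod L := Nat.pow_pos (by norm_num)
  rcases hcases with rfl | rfl | rfl | rfl | rfl | rfl | rfl
  · have hg : K / k6LoMod 1 < 16807 := by
      rw [Nat.div_lt_iff_lt_mul hM]; exact lt_of_lt_of_le hK (by show 7 ^ k6Ncr 1 ≤ 16807 * k6LoMod 1; decide)
    have h := bmKeys6_1 _ hg (j - goff6 1 (K / k6LoMod 1)) (by omega)
    rw [show goff6 1 (K / k6LoMod 1) + (j - goff6 1 (K / k6LoMod 1)) = j by omega, ← hKeq] at h; exact h
  · have hg : K / k6LoMod 2 < 16807 := by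
      rw [Nat.div_lt_iff_lt_mul hM]; exact lt_of_lt_of_le hK (by show 7 ^ k6Ncr 2 ≤ 16807 * k6LoMod 2; decide)
    have h := bmKeys6_2 _ hg (j - goff6 2 (K / k6LoMod 2)) (by omega)
    rw [show goff6 2 (K / k6LoMod 2) + (j - goff6 2 (K / k6LoMod 2)) = j by omega, ← hKeq] at h; exact h
  · have hg : K / k6LoMod 3 < 16807 := by
      rw [Nat.div_lt_iff_lt_mul hM]; exact lt_of_lt_of_le hK (by show 7 ^ k6Ncr 3 ≤ 16807 * k6LoMod 3; decide)
    have h := bmKeys6_3 _ hg (j - goff6 3 (K / k6LoMod 3)) (by omega)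
    rw [show goff6 3 (K / k6LoMod 3) + (j - goff6 3 (K / k6LoMod 3)) = j by omega, ← hKeq] at h; exact h
  · have hg : K / k6LoMod 4 < 16807 := by
      rw [Nat.div_lt_iff_lt_mul hM]; exact lt_of_lt_of_le hK (by show 7 ^ k6Ncr 4 ≤ 16807 * k6LoMod 4; decide)
    have h := bmKeys6_4 _ hg (j - goff6 4 (K / k6LoMod 4)) (by omega)
    rw [show goff6 4 (K / k6LoMod 4) + (j - goff6 4 (K / k6LoMod 4)) = j by omega, ← hKeq] at h; exact h
  · have hg : K / k6LoMod 5 < 2401 := by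
      rw [Nat.div_lt_iff_lt_mul hM]; exact lt_of_lt_of_le hK (by show 7 ^ k6Ncr 5 ≤ 2401 * k6LoMod 5; decide)
    have h := bmKeys6_5 _ hg (j - goff6 5 (K / k6LoMod 5)) (by omega)
    rw [show goff6 5 (K / k6LoMod 5) + (j - goff6 5 (K / k6LoMod 5)) = j by omega, ← hKeq] at h; exact h
  · have hg : K / k6LoMod 7 < 49 := by
      rw [Nat.div_lt_iff_lt_mul hM]; exact lt_of_lt_of_le hK (by show 7 ^ k6Ncr 7 ≤ 49 * k6LoMod 7; decide)
    have h := bmKeys6_7 _ hg (j - goff6 7 (K / k6LoMod 7)) (by omega)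
    rw [show goff6 7 (K / k6LoMod 7) + (j - goff6 7 (K / k6LoMod 7)) = j by omega, ← hKeq] at h; exact h
  · have hg : K / k6LoMod 13 < 7 := by
      rw [Nat.div_lt_iff_lt_mul hM]; exact lt_of_lt_of_le hK (by show 7 ^ k6Ncr 13 ≤ 7 * k6LoMod 13; decide)
    have h := bmKeys6_13 _ hg (j - goff6 13 (K / k6LoMod 13)) (by omega)
    rw [show goff6 13 (K / k6LoMod 13) + (j - goff6 13 (K / k6LoMod 13)) = j by omega, ← hKeq] at h; exact h

/-! ## Bucket completeness from the main check; level 1; the soundness theorem -/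

/-- The code of a slot column that agrees with `Q` on `Ω` is the code of `Q`. -/
theorem code6_congr {L : ℕ} (hL : L < 21) {Q Q' : ℕ → ℕ} (h : ∀ z < 42, Q z = Q' z) : code6 L Q = code6 L Q' := by
  unfold code6; rw [colKey6_congr L h, freeCode6_congr L hL h]

/-- Every bucket level is some `bktLev6 j`. -/
theorem exists_bktLev6 {L : ℕ} (hL : L < 21) (hB : k6IsBkt L = true) : ∃ j < 7, bktLev6 j = L := by
  have := k6IsBkt_cases hL hB
  rcases this with rfl | rfl | rfl | rfl | rfl | rfl | rfl
  exacts [⟨0, by norm_num, rfl⟩, ⟨1, by norm_num, rfl⟩, ⟨2, by norm_num, rfl⟩, ⟨3, by norm_num, rfl⟩, ⟨4, by norm_num, rfl⟩, ⟨5, by norm_num, rfl⟩,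
    ⟨6, by norm_num, rfl⟩]

/-- **Bucket completeness** (levels `≥ 2`, and level 1 for listed classes) from the main check: for every slack-6 pattern `Q` whose key at level `L`
is a table key, its free code is listed in the bucket — unless `L = 1` and `Q`'s class is unlisted, in which case `slotOK6` instead certifies the
level-1 subtrees (used separately). -/
theorem bucket_complete6 (hM : ∀ h < 336, LanesOK6 h 0 3692) {L : ℕ} (hL : L < 21) (hB : k6IsBkt L = true) {Q : ℕ → ℕ} (hQ : IsPat7 6 Q)
    {c' h' : ℕ} (hc' : c' < 3692) (hh' : h' < 336) (hQ' : ∀ z < 42, Q z = repVal6 c' (omAct7 h' z)) (htab : ¬ (L = 1 ∧ isTab6 c' = false))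
    {s e : ℕ} (hl : lookup6 L (colKey6 L Q) = some (s, e)) : freeCode6 L Q ∈ bucket6 L (colKey6 L Q) := by
  obtain ⟨j, hj, hjL⟩ := exists_bktLev6 hL hB
  have hslot := slotOK6_of_lanes ag6_facts hh' (hM h' hh') hj hc'
  rw [hjL, code6_congr hL (fun z hz => (hQ' z hz).symm)] at hslot
  obtain ⟨hkf, hff⟩ := code6_fields hL ((lev6_ok' hL).2.2.2.2.2.1.1 hB).2 hQ.1
  have hbm : bm6 L (code6 L Q / 2 ^ 39 % 2 ^ bmb6 L) = 1 := by rw [hkf]; exact bm6_of_table hB (colKey6_lt7 L Q) hl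
  have hmem := mem_bucket6_of_slotOK6 hslot hbm htab (by rw [hkf]; exact hl)
  rw [hff, hkf] at hmem; exact hmem

/-- Membership in a bucket, for a known entry range (kept symbolic in the level: a `match` on a concrete-level discriminant
with a symbolic key is never unfolded, see `MatMul22nRankGF7Slack6SearchSplit`). -/
theorem mem_bucket6_iff {L K s e f : ℕ} (hl : lookup6 L K = some (s, e)) : f ∈ bucket6 L K ↔ ∃ t < e - s, ent6 L (s + t) = f := by
  unfold bucket6; rw [hl]
  simp only [mem_image, mem_range]

/-- **What `slotOK6` certifies at level 1 for an unlisted class:** all level-1 subtrees of the classes needing this key die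
(the level is a hypothesis, not substituted, for the same reason). -/
theorem srch6_of_slotOK6_unlisted {L c code s e : ℕ} (hs : slotOK6 L c code = true) (hL : L = 1) (htab : isTab6 c = false)
    (hbm : bm6 L (code / 2 ^ 39 % 2 ^ bmb6 L) = 1) (hl : lookup6 L (code / 2 ^ 39) = some (s, e)) :
    ∀ i < nkoff6 (goff6 1 (code / 2 ^ 39) + 1) - nkoff6 (goff6 1 (code / 2 ^ 39)),
      srch6 20 2 (state2_6 (clsByNeed6 (nkoff6 (goff6 1 (code / 2 ^ 39)) + i)) (code % 2 ^ 39)) = true := by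
  unfold slotOK6 at hs
  simp only [hbm, hl, show ((1 : ℕ) == 0) = false from rfl, Bool.false_or, if_pos (And.intro hL htab)] at hs
  intro i hi
  exact List.all_eq_true.1 hs i (List.mem_range.2 hi)

/-- **Soundness of the slack-6 search certificate.** If every lane of every total plane passes (`LanesOK6 h 0 3692` for all 336 elements)
and `SearchT6 c` holds, then no LP-tight point of the slack-6 `𝔽₇` X-cap system (box `[0,6]`, the 1274 rows, total `≥ 312`) has torus-0
column `repVal6 c`. -/
theorem search6_sound (hM : ∀ h < 336, LanesOK6 h 0 3692) {c : ℕ} (hc : c < 3692) (hs : SearchT6 c) (x : ℕ → ℕ) (_hbox : ∀ j, x j ≤ 6)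
    (hrows : ∀ r < 1274, capRowVal7 x r ≤ rhs7s 6 r) (hge : (312 : ℤ) ≤ ∑ j ∈ range 401, (x j : ℤ))
    (hcol : ∀ z < 42, colN7 x 0 z = repVal6 c z) : False := by
  obtain ⟨_, hT, hR, _, _⟩ := tight7_of_total_ge 6 x hrows (by push_cast; linarith)
  have hpat : ∀ j < 21, IsPat7 6 (colN7 x j) := fun j hj => slack6_tight_cols7 x hrows hge hj
  have hx : ∀ j < 21, ∀ z < 42, colN7 x j z ≤ 6 := fun j hj z hz => (hpat j hj).1 z hz
  have hT' : ∀ t < 384, xrs7 x t = 6 := fun t ht => by exact_mod_cast hT t ht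
  have hF := levFacts6 x hx hT' hR
  have hC : ∀ L < 21, 2 ≤ L → k6IsBkt L = true → ∀ Q : ℕ → ℕ, IsPat7 6 Q →
      ∀ s e, lookup6 L (colKey6 L Q) = some (s, e) → freeCode6 L Q ∈ bucket6 L (colKey6 L Q) := by
    intro L hL hL2 hB Q hQ s e hl
    obtain ⟨c', hc', h', hh', hQ'⟩ := slot_of_pat6 hQ
    exact bucket_complete6 hM hL hB hQ hc' hh' hQ' (by omega) hl
  -- level 1: the key of the true column is the need key of the class
  have hkey1 : needKey6 1 (repW6 c) = colKey6 1 (colN7 x (torOf6 1)) := by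
    rw [repW6_eq x hcol]; exact hF.need 1 (by norm_num) rfl
  have hQ1 : IsPat7 6 (colN7 x (torOf6 1)) := hpat _ (torOf6_lt (by norm_num))
  have hchild : srch6 20 2 (state2_6 c (freeCode6 1 (colN7 x (torOf6 1)))) = true → False := fun h2 => by
    rw [state2_6_eq x hx hcol] at h2; exact srch6_sound x hpat hF hC 20 2 le_rfl h2
  have hr : range1_6 c = lookup6 1 (colKey6 1 (colN7 x (torOf6 1))) := by unfold range1_6; rw [hkey1]
  unfold SearchT6 at hs
  rw [hr] at hs
  cases hl1 : lookup6 1 (colKey6 1 (colN7 x (torOf6 1))) with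
  | none => rw [hl1] at hs; simp [fullOK6] at hs
  | some se =>
    obtain ⟨s, e⟩ := se
    rw [hl1] at hs
    simp only [fullOK6, List.all_eq_true, List.mem_range] at hs
    obtain ⟨c', hc', h', hh', hQ'⟩ := slot_of_pat6 hQ1
    by_cases htab : isTab6 c' = true
    · -- listed class: the true child is a listed entry
      have hmem := bucket_complete6 hM (by norm_num) rfl hQ1 hc' hh' hQ' (by simp [htab]) hl1
      obtain ⟨t, ht, hte⟩ := (mem_bucket6_iff hl1).1 hmem
      have h2 := hs t ht
      rw [hte] at h2
      exact hchild h2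
    · -- unlisted class: the main check ran the level-1 subtrees of every class needing this key, among them `c`
      have htab' : isTab6 c' = false := by simpa using htab
      have hslot := slotOK6_of_lanes ag6_facts hh' (hM h' hh') (show 0 < 7 by norm_num) hc'
      rw [show bktLev6 0 = 1 from rfl, code6_congr (by norm_num) (fun z hz => (hQ' z hz).symm)] at hslot
      obtain ⟨hkf, hff⟩ := code6_fields (L := 1) (by norm_num) le_rfl hQ1.1
      have hbm : bm6 1 (code6 1 (colN7 x (torOf6 1)) / 2 ^ 39 % 2 ^ bmb6 1) = 1 := by
        rw [hkf]; exact bm6_of_table rfl (colKey6_lt7 1 _) hl1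
      have hsub := srch6_of_slotOK6_unlisted hslot rfl htab' hbm (by rw [hkf]; exact hl1)
      rw [hkf, hff] at hsub
      -- class `c` is listed under its need key
      obtain ⟨_, i, _, hi, hci⟩ := clsFacts6 c hc
      rw [hkey1] at hi hci
      have h2 := hsub i hi
      rw [hci] at h2
      exact hchild h2

/-- **The slack-6 certificate, replayed in pieces, refutes every representative:** `NoTightPoint7 6 312` from the two replayed facts
(CHECK B for all 3 692 classes, MAIN CHECK lanes for all 336 elements). -/
theorem noTightPoint7_6_312_of_replay (hT : ∀ c < 3692, SearchT6 c) (hM : ∀ h < 336, LanesOK6 h 0 3692) : NoTightPoint7 6 312 :=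
  noTightPoint7_6_312_of_reps fun c hc x hbox hrows hge hcol => search6_sound hM hc (hT c hc) x hbox hrows hge hcol

end Summit.MatrixMultiplication.OmegaCensus.SmallFormats
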